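import Literature.NumberTheory.Automorphic.BrandtModuleResidueSplit
import HarnessLib

/-!
# Residual classification II: a central non-trivial idempotent with a nilpotent corner
# contradicts maximality

Eighth layer of the proof files for the named fact `brandtMatrix_comm` of `BrandtModule.lean`
(Vignéras, LNM 800, III §5 ex. 5.8; Eichler 1973, II §6 Thm. 2). We continue the residual
classification of `A = O₁ / p O₁` for a maximal order `O₁` in the *central* case of the size
constraint (`IsZOrder.card_peirceCorner_cases`): a non-trivial idempotent `e` (`ē = f = 1 − e`)
with `eAf = fAe = 0` and `|eAe| = |fAf| = p²`. Then `e` is central and `A = eAe × fAf`.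

* `IsZOrder.exists_pair_of_mem_peirceCorner` — a corner of order `p²` is spanned by any two
  "independent" elements (counting);
* `IsZOrder.central_of_corners_trivial` — `eAf = fAe = 0` makes `e` central;
* **the nilpotent-corner case contradicts maximality** (`IsMaximalZOrder.false_of_central_sq_zero`,
  residual shadow of the non-maximality of `ℤ + p O'`-type orders): if `eAe ∋ ε ≠ 0` with
  `ε² = 0`, lift `e` to `E` (`E² ≡ E mod p²`), put `ε̃ = E ε₀ E`, `ε̃' = F ε̄₀ F`,
  `𝔄 = ℤ ε̃ + ℤ ε̃' + p O₁`; a mod-`p²` computation shows `p² ∣ nrd(ε̃)` (the `f`-component of the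
  scalar `nrd(ε̃)/p` must vanish), whence `ε̃ 𝔄 ⊆ p 𝔄` and `ε̃ ∈ p O₁` by **(M1)** — contradicting
  `res ε̃ = ε ≠ 0`.

The remaining central sub-case (no nilpotent in `eAe`: `A` is reduced and commutative) is excluded
in `BrandtModuleResidueCommutative.lean` without using maximality.

## References

* M.-F. Vignéras, *Arithmétique des algèbres de quaternions*, LNM 800 (1980), Ch. I §4, Ch. II
  §§1–2 [VignerasLNM800].
-/

noncomputable section

open scoped Pointwise

universe u

namespace Literature.NumberTheory.Automorphic

namespace IsZOrder

variable {B : Type u} [Ring B] [Algebra ℚ B] [IsQuaternionAlgebra ℚ B] {O : Submodule ℤ B} {p : ℕ}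

/-! ### Corners of order `p²` are planes -/

omit [Algebra ℚ B] [IsQuaternionAlgebra ℚ B] in
/-- **A Peirce corner of order `p²` is spanned by any two independent elements**: if
`c₁, c₂ ∈ corner` satisfy `k c₁ + l c₂ = 0 → p ∣ k ∧ p ∣ l`, then every element of the corner is
`k c₁ + l c₂` (the map `(k, l) ↦ k c₁ + l c₂` on `(ℤ/p)²` is injective, hence onto). [folklore] -/
theorem exists_pair_of_mem_peirceCorner (hO : IsZOrder O) (hp : p.Prime) {e e' c₁ c₂ : hO.Residue p}
    (hc₁ : c₁ ∈ peirceCorner e e') (hc₂ : c₂ ∈ peirceCorner e e')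
    (hind : ∀ k l : ℤ, (k : hO.Residue p) * c₁ + (l : hO.Residue p) * c₂ = 0 → (p : ℤ) ∣ k ∧ (p : ℤ) ∣ l)
    (hcard : Nat.card (peirceCorner e e') = p ^ 2) :
    ∀ a ∈ peirceCorner e e', ∃ k l : ℤ, a = (k : hO.Residue p) * c₁ + (l : hO.Residue p) * c₂ := by
  classical
  haveI : NeZero p := ⟨hp.ne_zero⟩
  haveI : Finite (peirceCorner e e') :=
    Nat.finite_of_card_ne_zero (by rw [hcard]; exact pow_ne_zero 2 hp.ne_zero)
  letI : Fintype (peirceCorner e e') := Fintype.ofFinite _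
  let g : ZMod p × ZMod p → peirceCorner e e' := fun kl =>
    ⟨((kl.1.val : ℤ) : hO.Residue p) * c₁ + ((kl.2.val : ℤ) : hO.Residue p) * c₂,
      (peirceCorner e e').add_mem
        (by rw [← zsmul_eq_mul]; exact (peirceCorner e e').zsmul_mem hc₁ _)
        (by rw [← zsmul_eq_mul]; exact (peirceCorner e e').zsmul_mem hc₂ _)⟩
  have hinj : Function.Injective g := by
    rintro ⟨k, l⟩ ⟨k', l'⟩ h
    have h' := congrArg Subtype.val h
    simp only [g] at h'
    have h0 : (((k.val : ℤ) - k'.val : ℤ) : hO.Residue p) * c₁ +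
        (((l.val : ℤ) - l'.val : ℤ) : hO.Residue p) * c₂ = 0 := by
      rw [Int.cast_sub, Int.cast_sub, sub_mul, sub_mul]
      have := sub_eq_zero.mpr h'
      rw [← this]
      abel
    obtain ⟨hk, hl⟩ := hind _ _ h0
    have hk' : ((k'.val : ℤ) : ZMod p) = ((k.val : ℤ) : ZMod p) :=
      (ZMod.intCast_eq_intCast_iff_dvd_sub _ _ p).mpr hk
    have hl' : ((l'.val : ℤ) : ZMod p) = ((l.val : ℤ) : ZMod p) :=
      (ZMod.intCast_eq_intCast_iff_dvd_sub _ _ p).mpr hl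
    simp only [Int.cast_natCast, ZMod.natCast_zmod_val] at hk' hl'
    rw [hk', hl']
  have hbij : Function.Bijective g := by
    rw [Fintype.bijective_iff_injective_and_card]
    refine ⟨hinj, ?_⟩
    rw [Fintype.card_prod, ZMod.card, ← Nat.card_eq_fintype_card, hcard, pow_two]
  intro a ha
  obtain ⟨⟨k, l⟩, hkl⟩ := hbij.2 ⟨a, ha⟩
  exact ⟨k.val, l.val, by simpa [g] using (congrArg Subtype.val hkl).symm⟩

omit [Algebra ℚ B] [IsQuaternionAlgebra ℚ B] in
/-- An additive subgroup of cardinality `1` is trivial: its elements vanish. [folklore] -/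
theorem eq_zero_of_card_eq_one (hO : IsZOrder O) {H : AddSubgroup (hO.Residue p)} (hH : Nat.card H = 1)
    {a : hO.Residue p} (ha : a ∈ H) : a = 0 := by
  have := (AddSubgroup.eq_bot_iff_card H).mpr hH
  rw [this] at ha
  exact ha

omit [Algebra ℚ B] [IsQuaternionAlgebra ℚ B] in
/-- **Trivial off-diagonal corners make the idempotent central**: if `eAf = fAe = 0` then
`e a = e a e = a e` for all `a`. [folklore] -/
theorem central_of_corners_trivial (hO : IsZOrder O) {e : hO.Residue p} (he : IsIdempotentElem e)
    (hef : Nat.card (peirceCorner e (1 - e)) = 1) (hfe : Nat.card (peirceCorner (1 - e) e) = 1)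
    (a : hO.Residue p) : e * a = e * a * e ∧ a * e = e * a * e := by
  have h1 : e * a * (1 - e) = 0 :=
    hO.eq_zero_of_card_eq_one hef (mul_mul_mem_peirceCorner he he.one_sub a)
  have h2 : (1 - e) * a * e = 0 :=
    hO.eq_zero_of_card_eq_one hfe (mul_mul_mem_peirceCorner he.one_sub he a)
  constructor
  · calc e * a = e * a * e + e * a * (1 - e) := by noncomm_ring
      _ = e * a * e := by rw [h1, add_zero]
  · calc a * e = e * a * e + (1 - e) * a * e := by noncomm_ring
      _ = e * a * e := by rw [h2, add_zero]

/-! ### A square-zero element of a diagonal corner -/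

/-- For `ε = res z` with `ε ≠ 0`, `ε² = 0` lying in `eAe` (`e` an idempotent with `1 − e ≠ 0`):
`p ∣ trd(z)` and `p ∣ nrd(z)` (`n = t ε` is a scalar in `eAe`, so its `f`-component `n f`
vanishes). [folklore] -/
theorem dvd_trdZ_nrdZ_of_sq_zero (hO : IsZOrder O) (hp : p.Prime) {e : hO.Residue p}
    (he : IsIdempotentElem e) (hf0 : (1 : hO.Residue p) - e ≠ 0) {z : hO.subring}
    (hze : hO.res p z ∈ peirceCorner e e) (hz0 : hO.res p z ≠ 0) (hzz : hO.res p z * hO.res p z = 0) :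
    (p : ℤ) ∣ trdZ (z : B) ∧ (p : ℤ) ∣ nrdZ (z : B) := by
  set ε := hO.res p z
  have hsq := hO.res_mul_res (p := p) z
  rw [hzz] at hsq
  have hN : (nrdZ (z : B) : hO.Residue p) = (trdZ (z : B) : hO.Residue p) * ε :=
    (sub_eq_zero.mp hsq.symm).symm
  have hNf : (nrdZ (z : B) : hO.Residue p) * (1 - e) = 0 := by
    rw [hN, mul_assoc, mul_right_eq_zero_of_mem_peirceCorner hze he.mul_one_sub_self, mul_zero]
  have hn : (p : ℤ) ∣ nrdZ (z : B) := hO.dvd_of_intCast_mul_eq_zero hp hf0 hNf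
  refine ⟨?_, hn⟩
  have hT : (trdZ (z : B) : hO.Residue p) * ε = 0 := by
    rw [← hN]; exact (hO.intCast_residue_eq_zero_iff hp).mpr hn
  exact hO.dvd_of_intCast_mul_eq_zero hp hz0 hT

/-- In the central case, `eAe` is spanned by `e` and any non-zero square-zero `ε ∈ eAe`. [folklore] -/
theorem exists_pair_e_eps (hO : IsZOrder O) (hp : p.Prime) {e ε : hO.Residue p} (he : IsIdempotentElem e)
    (hε : ε ∈ peirceCorner e e) (hε0 : ε ≠ 0) (hεε : ε * ε = 0)
    (hee : Nat.card (peirceCorner e e) = p ^ 2) :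
    ∀ a ∈ peirceCorner e e, ∃ k l : ℤ, a = (k : hO.Residue p) * e + (l : hO.Residue p) * ε := by
  refine hO.exists_pair_of_mem_peirceCorner hp (by rw [mem_peirceCorner, he.eq, he.eq]) hε ?_ hee
  intro k l hkl
  have heε : e * ε = ε := mul_left_eq_self_of_mem_peirceCorner he hε
  -- multiply by `ε` on the right: `k ε = 0`
  have hk : (k : hO.Residue p) * ε = 0 := by
    have := congrArg (· * ε) hkl
    simpa only [add_mul, mul_assoc, heε, hεε, mul_zero, add_zero, zero_mul] using this
  have hpk := hO.dvd_of_intCast_mul_eq_zero hp hε0 hk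
  rw [(hO.intCast_residue_eq_zero_iff hp).mpr hpk, zero_mul, zero_add] at hkl
  exact ⟨hpk, hO.dvd_of_intCast_mul_eq_zero hp hε0 hkl⟩

/-- In the central case an element acts on a square-zero corner element by a scalar:
`z̄ ε = k ε` (`z̄ ε = (e z̄ e) ε = (k e + l ε) ε`). [folklore] -/
theorem exists_res_mul_eps (hO : IsZOrder O) (hp : p.Prime) {e ε : hO.Residue p} (he : IsIdempotentElem e)
    (hε : ε ∈ peirceCorner e e) (hε0 : ε ≠ 0) (hεε : ε * ε = 0)
    (hee : Nat.card (peirceCorner e e) = p ^ 2)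
    (hcen : ∀ a : hO.Residue p, e * a = e * a * e ∧ a * e = e * a * e) (z : hO.Residue p) :
    ∃ k : ℤ, z * ε = (k : hO.Residue p) * ε ∧ ε * z = (k : hO.Residue p) * ε := by
  obtain ⟨k, l, hkl⟩ := hO.exists_pair_e_eps hp he hε hε0 hεε hee _ (mul_mul_mem_peirceCorner he he z)
  have heε : e * ε = ε := mul_left_eq_self_of_mem_peirceCorner he hε
  have hεe : ε * e = ε := mul_right_eq_self_of_mem_peirceCorner he hε
  refine ⟨k, ?_, ?_⟩
  · calc z * ε = z * (e * ε) := by rw [heε]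
      _ = e * z * e * ε := by rw [← mul_assoc, (hcen z).2]
      _ = ((k : hO.Residue p) * e + (l : hO.Residue p) * ε) * ε := by rw [hkl]
      _ = (k : hO.Residue p) * ε := by rw [add_mul, mul_assoc, heε, mul_assoc, hεε, mul_zero, add_zero]
  · calc ε * z = ε * e * z := by rw [hεe]
      _ = ε * (e * z) := mul_assoc _ _ _
      _ = ε * (e * z * e) := by congr 1; exact (hcen z).1
      _ = ε * ((k : hO.Residue p) * e + (l : hO.Residue p) * ε) := by rw [hkl]
      _ = (k : hO.Residue p) * ε := by
        rw [mul_add, ← mul_assoc, ← (Int.cast_commute k ε).eq, mul_assoc, hεe, ← mul_assoc,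
          ← (Int.cast_commute l ε).eq, mul_assoc, hεε, mul_zero, add_zero]

/-! ### The nilpotent-corner case contradicts maximality -/

/-- **The mod-`p²` computation** of the central nilpotent-corner case: with `e` an idempotent of
`A = O / p O`, `1 − e ≠ 0`, `ε ∈ eAe` non-zero of square zero, a lift `E ∈ O` of `e` with
`E² ≡ E (mod p²)` and a lift `z` of `ε`, the element `ε̃ = E z E` has `p² ∣ nrd(ε̃)`: writing
`w = E z E z E = p d`, one has `ε̃² ≡ w`, `E w E ≡ w (mod p²)`, so `d ≡ t' ε̃ − n''` with
`e d̄ e = d̄`, forcing `n'' (1 − e) = 0`. [folklore] -/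
theorem sq_dvd_nrdZ_of_central_lift [IsAddTorsionFree B] (hO : IsZOrder O) (hp : p.Prime)
    {e ε : hO.Residue p} (he : IsIdempotentElem e) (hf0 : (1 : hO.Residue p) - e ≠ 0)
    (hε : ε ∈ peirceCorner e e) (hε0 : ε ≠ 0) (hεε : ε * ε = 0)
    {E : B} (hE : E ∈ O) (hEe : hO.res p ⟨E, hE⟩ = e) (hEE : E * E - E ∈ ((p : ℤ) * p) • O)
    {z : B} (hz : z ∈ O) (hzε : hO.res p ⟨z, hz⟩ = ε) :
    ((p : ℤ) * p) ∣ nrdZ (E * z * E) := by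
  have hpZ : (p : ℤ) ≠ 0 := by exact_mod_cast hp.ne_zero
  have heε : e * ε = ε := mul_left_eq_self_of_mem_peirceCorner he hε
  have hεe : ε * e = ε := mul_right_eq_self_of_mem_peirceCorner he hε
  have hepsO : E * z * E ∈ O := hO.mul_mem _ (hO.mul_mem _ hE _ hz) _ hE
  obtain ⟨eps, heps⟩ : ∃ y : hO.subring, (y : B) = E * z * E := ⟨⟨_, hepsO⟩, rfl⟩
  have hres_eps : hO.res p eps = ε := by
    have : eps = ⟨E, hE⟩ * ⟨z, hz⟩ * ⟨E, hE⟩ := Subtype.ext (by simp only [Subring.coe_mul, heps])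
    rw [this, map_mul, map_mul, hEe, hzε]; exact mem_peirceCorner.mp hε
  obtain ⟨⟨t', ht'⟩, ⟨n₂, hn₂⟩⟩ := hO.dvd_trdZ_nrdZ_of_sq_zero hp he hf0 (z := eps)
    (by rw [hres_eps]; exact hε) (by rw [hres_eps]; exact hε0) (by rw [hres_eps]; exact hεε)
  rw [heps] at ht' hn₂
  have hsq : E * z * E * (E * z * E) = (p : ℤ) • ((t' : ℤ) • (E * z * E) - (n₂ : ℤ) • (1 : B)) := by
    rw [hO.mul_self_eq_trdZ hepsO, ht', hn₂, smul_sub, smul_smul, smul_smul]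
  -- `w = E z E z E = p • d`
  have hwO : E * z * E * z * E ∈ O := hO.mul_mem _ (hO.mul_mem _ hepsO _ hz) _ hE
  obtain ⟨w, hw⟩ : ∃ y : hO.subring, (y : B) = E * z * E * z * E := ⟨⟨_, hwO⟩, rfl⟩
  have hresw : hO.res p w = 0 := by
    have : w = ⟨E, hE⟩ * ⟨z, hz⟩ * ⟨E, hE⟩ * ⟨z, hz⟩ * ⟨E, hE⟩ :=
      Subtype.ext (by simp only [Subring.coe_mul, hw])
    rw [this, map_mul, map_mul, map_mul, map_mul, hEe, hzε]
    calc e * ε * e * ε * e = (e * ε * e) * ε * e := by noncomm_ring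
      _ = ε * ε * e := by rw [mem_peirceCorner.mp hε]
      _ = 0 := by rw [hεε, zero_mul]
  obtain ⟨d, hd, hwd⟩ := (Submodule.mem_smul_pointwise_iff_exists _ _ O).mp (res_eq_zero_iff.mp hresw)
  rw [hw] at hwd
  -- (a) `ε̃² − w ∈ p² O`
  have ha : E * z * E * (E * z * E) - E * z * E * z * E ∈ ((p : ℤ) * p) • O := by
    have : E * z * E * (E * z * E) - E * z * E * z * E = E * z * (E * E - E) * (z * E) := by noncomm_ring
    rw [this]
    exact hO.smul_mul_mem (hO.mul_smul_mem (hO.mul_mem _ hE _ hz) hEE) (hO.mul_mem _ hz _ hE)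
  -- (c) `E d E − d ∈ p O`
  have hc : E * d * E - d ∈ (p : ℤ) • O := by
    refine mem_smul_of_smul_mem_smul O hpZ ?_
    have : (p : ℤ) • (E * d * E - d) = E * (E * z * E * z * E) * E - E * z * E * z * E := by
      rw [smul_sub, ← smul_mul_assoc, ← mul_smul_comm, hwd]
    rw [this]
    have : E * (E * z * E * z * E) * E - E * z * E * z * E =
        (E * E - E) * (z * E * z * E * E) + E * z * E * z * (E * E - E) := by noncomm_ring
    rw [this]
    exact Submodule.add_mem _
      (hO.smul_mul_mem hEE (hO.mul_mem _ (hO.mul_mem _ (hO.mul_mem _ (hO.mul_mem _ hz _ hE) _ hz) _ hE) _ hE))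
      (hO.mul_smul_mem (hO.mul_mem _ (hO.mul_mem _ (hO.mul_mem _ hE _ hz) _ hE) _ hz) hEE)
  -- (d) `d − (t' ε̃ − n₂·1) ∈ p O`
  have hdres : d - ((t' : ℤ) • (E * z * E) - (n₂ : ℤ) • (1 : B)) ∈ (p : ℤ) • O := by
    refine mem_smul_of_smul_mem_smul O hpZ ?_
    rw [smul_sub, hwd, ← hsq]
    have := Submodule.neg_mem _ ha
    rwa [neg_sub] at this
  obtain ⟨ds, hds⟩ : ∃ y : hO.subring, (y : B) = d := ⟨⟨d, hd⟩, rfl⟩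
  have hd_res : hO.res p ds = (t' : hO.Residue p) * ε - (n₂ : hO.Residue p) := by
    have : hO.res p ds = hO.res p ((t' : hO.subring) * eps - (n₂ : hO.subring)) := by
      rw [res_eq_res_iff]
      simpa only [AddSubgroupClass.coe_sub, Subring.coe_mul, Subring.coe_intCast, zsmul_eq_mul, mul_one,
        heps, hds] using hdres
    rw [this, map_sub, map_mul, map_intCast, map_intCast, hres_eps]
  have he_d : e * hO.res p ds * e = hO.res p ds := by
    have h : hO.res p (⟨E, hE⟩ * ds * ⟨E, hE⟩ - ds) = 0 := by
      rw [res_eq_zero_iff]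
      simpa only [AddSubgroupClass.coe_sub, Subring.coe_mul, hds] using hc
    rw [map_sub, map_mul, map_mul, hEe, sub_eq_zero] at h
    exact h
  have hlhs : e * ((t' : hO.Residue p) * ε - (n₂ : hO.Residue p)) * e =
      (t' : hO.Residue p) * ε - (n₂ : hO.Residue p) * e := by
    have h1 : e * ((t' : hO.Residue p) * ε) * e = (t' : hO.Residue p) * ε := by
      calc e * ((t' : hO.Residue p) * ε) * e = (e * (t' : hO.Residue p)) * (ε * e) := by noncomm_ring
        _ = ((t' : hO.Residue p) * e) * ε := by rw [hεe, (Int.cast_commute t' e).eq]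
        _ = (t' : hO.Residue p) * (e * ε) := mul_assoc _ _ _
        _ = (t' : hO.Residue p) * ε := by rw [heε]
    have h2 : e * (n₂ : hO.Residue p) * e = (n₂ : hO.Residue p) * e := by
      rw [← (Int.cast_commute n₂ e).eq, mul_assoc, he.eq]
    rw [mul_sub, sub_mul, h1, h2]
  rw [hd_res, hlhs] at he_d
  have hnf : (n₂ : hO.Residue p) * (1 - e) = 0 := by
    rw [mul_sub, mul_one]
    have := congrArg (fun y => (t' : hO.Residue p) * ε - y) he_d
    simp only [sub_sub_cancel] at this
    rw [this, sub_self]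
  obtain ⟨n₃, hn₃⟩ := hO.dvd_of_intCast_mul_eq_zero hp hf0 hnf
  exact ⟨n₃, by rw [hn₂, hn₃, mul_assoc]⟩

/-- **A central non-trivial idempotent with a nilpotent corner contradicts maximality.** Let `O₁`
be maximal, `e = res x` a non-trivial idempotent of `A = O₁ / p O₁` (`ē = 1 − e`) with
`eAf = fAe = 0`, `|eAe| = p²`, and `eAe ∋ ε ≠ 0` with `ε² = 0`. Then `False` (see the module
docstring for the mod-`p²` computation and the (M1) step). [cite: VignerasLNM800, Ch. I §4 and Ch. II §1] -/
theorem _root_.Literature.NumberTheory.Automorphic.IsMaximalZOrder.false_of_central_sq_zero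
    [IsAddTorsionFree B] {O₁ : Submodule ℤ B} (hO : IsZOrder O₁) (hmax : IsMaximalZOrder O₁)
    (hp : p.Prime) {x : hO.subring} (he : IsIdempotentElem (hO.res p x))
    (h1 : hO.res p x ≠ 1) (hbar : hO.barA p (hO.res p x) = 1 - hO.res p x)
    (hef : Nat.card (peirceCorner (hO.res p x) (1 - hO.res p x)) = 1)
    (hfe : Nat.card (peirceCorner (1 - hO.res p x) (hO.res p x)) = 1)
    (hee : Nat.card (peirceCorner (hO.res p x) (hO.res p x)) = p ^ 2)
    {ε : hO.Residue p} (hε : ε ∈ peirceCorner (hO.res p x) (hO.res p x)) (hε0 : ε ≠ 0)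
    (hεε : ε * ε = 0) : False := by
  generalize he_def : hO.res p x = e at he h1 hbar hef hfe hee hε
  have hf := he.one_sub
  have hpZ : (p : ℤ) ≠ 0 := by exact_mod_cast hp.ne_zero
  have hf0 : (1 : hO.Residue p) - e ≠ 0 := fun h => h1 (sub_eq_zero.mp h).symm
  have hcen := hO.central_of_corners_trivial he hef hfe
  have heε : e * ε = ε := mul_left_eq_self_of_mem_peirceCorner he hε
  have hεe : ε * e = ε := mul_right_eq_self_of_mem_peirceCorner he hε
  -- lift `e` to `E` with `E² ≡ E (mod p²)`
  have hxx : (x : B) * x - x ∈ (p : ℤ) • O₁ :=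
    res_eq_zero_iff.mp (show hO.res p (x * x - x) = 0 by rw [map_sub, map_mul, he_def, he.eq, sub_self])
  obtain ⟨E, hE, hEx, hEE⟩ := hO.exists_lift_idempotent_sq (p : ℤ) x.2 hxx
  obtain ⟨Es, hEs⟩ : ∃ y : hO.subring, (y : B) = E := ⟨⟨E, hE⟩, rfl⟩
  have hresE : hO.res p Es = e := by rw [← he_def, res_eq_res_iff, hEs]; exact hEx
  obtain ⟨hEF, -⟩ := lift_mul_compl hEE
  -- `ε̃ = E ε₀ E` and `ε̃' = F ε̄₀ F`, as elements of `B` and of the subring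
  obtain ⟨ε₀, hε₀⟩ := hO.res_surjective p ε
  obtain ⟨epsB, hepsB⟩ : ∃ y : B, y = E * ε₀ * E := ⟨_, rfl⟩
  have hepsO : epsB ∈ O₁ := by rw [hepsB]; exact hO.mul_mem _ (hO.mul_mem _ hE _ ε₀.2) _ hE
  obtain ⟨eps, heps⟩ : ∃ y : hO.subring, (y : B) = epsB := ⟨⟨epsB, hepsO⟩, rfl⟩
  have hres_eps : hO.res p eps = ε := by
    have : eps = Es * ε₀ * Es := Subtype.ext (by simp only [Subring.coe_mul, heps, hEs]; exact hepsB)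
    rw [this, map_mul, map_mul, hresE, hε₀]; exact mem_peirceCorner.mp hε
  obtain ⟨ε', hε'_def⟩ : ∃ y : hO.Residue p, y = hO.barA p ε := ⟨_, rfl⟩
  obtain ⟨ε₀', hε₀'⟩ := hO.res_surjective p ε'
  obtain ⟨epsB', hepsB'⟩ : ∃ y : B, y = (1 - E) * ε₀' * (1 - E) := ⟨_, rfl⟩
  have hepsO' : epsB' ∈ O₁ := by
    rw [hepsB']
    exact hO.mul_mem _ (hO.mul_mem _ (O₁.sub_mem hO.one_mem hE) _ ε₀'.2) _ (O₁.sub_mem hO.one_mem hE)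
  obtain ⟨eps', heps'⟩ : ∃ y : hO.subring, (y : B) = epsB' := ⟨⟨epsB', hepsO'⟩, rfl⟩
  have hε' : ε' ∈ peirceCorner (1 - e) (1 - e) := by
    rw [hε'_def]
    simpa only [hbar] using hO.barA_mem_peirceCorner hε
  have hres_eps' : hO.res p eps' = ε' := by
    have : eps' = (1 - Es) * ε₀' * (1 - Es) :=
      Subtype.ext (by simp only [Subring.coe_mul, AddSubgroupClass.coe_sub, Subring.coe_one, heps', hEs]; exact hepsB')
    rw [this, map_mul, map_mul, map_sub, map_one, hresE, hε₀']; exact mem_peirceCorner.mp hε'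
  have hε'0 : ε' ≠ 0 := fun h => hε0 (by rw [← hO.barA_barA ε, ← hε'_def, h, barA_zero])
  have hε'ε' : ε' * ε' = 0 := by rw [hε'_def, ← barA_mul, hεε, barA_zero]
  have hff : Nat.card (peirceCorner (1 - e) (1 - e)) = p ^ 2 := by rw [← hO.card_peirceCorner_eq hbar, hee]
  -- centrality of `f = 1 - e` in the same form
  have hcenf : ∀ a : hO.Residue p, (1 - e) * a = (1 - e) * a * (1 - e) ∧ a * (1 - e) = (1 - e) * a * (1 - e) := by
    intro a
    have h2 : a * e = e * a := ((hcen a).1.trans (hcen a).2.symm).symm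
    have h3 : e * a * e = e * a := (hcen a).1.symm
    have hexp : (1 - e) * a * (1 - e) = a - e * a - a * e + e * a * e := by noncomm_ring
    rw [hexp, h3, h2]
    constructor
    · noncomm_ring
    · rw [mul_sub, mul_one, h2]; noncomm_ring
  -- arithmetic of `ε̃`: `trd = p t'`, `nrd = p n''`
  obtain ⟨⟨t', ht'⟩, ⟨n'', hn''⟩⟩ := hO.dvd_trdZ_nrdZ_of_sq_zero hp he hf0 (z := eps)
    (by rw [hres_eps]; exact hε) (by rw [hres_eps]; exact hε0) (by rw [hres_eps]; exact hεε)
  rw [heps] at ht' hn''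
  -- `ε̃² = p • (t' ε̃ − n''·1)`
  have hsq : epsB * epsB = (p : ℤ) • ((t' : ℤ) • epsB - (n'' : ℤ) • (1 : B)) := by
    rw [hO.mul_self_eq_trdZ hepsO, ht', hn'', smul_sub, smul_smul, smul_smul]
  -- the key divisibility `p² ∣ nrd(ε̃)` (`sq_dvd_nrdZ_of_central_lift`), i.e. `p ∣ n''`
  have hkey : ((p : ℤ) * p) ∣ nrdZ epsB := by
    have hEe : hO.res p ⟨E, hE⟩ = e := by
      rw [← hresE]; congr 1; exact Subtype.ext hEs.symm
    rw [hepsB]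
    exact hO.sq_dvd_nrdZ_of_central_lift hp he hf0 hε hε0 hεε hE hEe hEE ε₀.2 (by rw [← hε₀])
  obtain ⟨n''', hn'''⟩ : (p : ℤ) ∣ n'' := by
    obtain ⟨c, hc⟩ := hkey
    refine ⟨c, mul_left_cancel₀ hpZ ?_⟩
    rw [← hn'', hc, mul_assoc]
  -- the lattice `𝔄 = ℤ ε̃ + ℤ ε̃' + p O₁`
  obtain ⟨𝔄, h𝔄⟩ : ∃ A : Submodule ℤ B, A = Submodule.span ℤ {epsB, epsB'} ⊔ (p : ℤ) • O₁ := ⟨_, rfl⟩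
  have hmem𝔄 : ∀ {a : B}, a ∈ 𝔄 ↔ ∃ k l : ℤ, a - (k • epsB + l • epsB') ∈ (p : ℤ) • O₁ := by
    intro a
    rw [h𝔄, Submodule.mem_sup]
    constructor
    · rintro ⟨y, hy, z, hz, rfl⟩
      obtain ⟨k, l, rfl⟩ := Submodule.mem_span_pair.mp hy
      exact ⟨k, l, by rwa [add_sub_cancel_left]⟩
    · rintro ⟨k, l, h⟩
      exact ⟨_, Submodule.mem_span_pair.mpr ⟨k, l, rfl⟩, _, h, by abel⟩
  have hlow : (p : ℤ) • O₁ ≤ 𝔄 := h𝔄 ▸ le_sup_right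
  have hup : 𝔄 ≤ O₁ := h𝔄 ▸ sup_le (Submodule.span_le.mpr (by
    rintro z (rfl | rfl)
    · exact hepsO
    · exact hepsO')) (smul_le O₁ _)
  have hsmul𝔄 : ∀ {b : B}, b ∈ 𝔄 → (p : ℤ) • b ∈ (p : ℤ) • 𝔄 := fun hb =>
    Submodule.smul_mem_pointwise_smul _ _ 𝔄 hb
  -- the scalar actions `z̄ ε = k ε`, `z̄ ε' = k ε'` lifted to `B`
  have hzeps : ∀ z ∈ O₁, ∃ k : ℤ, z * epsB - k • epsB ∈ (p : ℤ) • O₁ ∧ epsB * z - k • epsB ∈ (p : ℤ) • O₁ := by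
    intro z hz
    obtain ⟨k, hk1, hk2⟩ := hO.exists_res_mul_eps hp he hε hε0 hεε hee hcen (hO.res p ⟨z, hz⟩)
    refine ⟨k, ?_, ?_⟩
    · have h : hO.res p (⟨z, hz⟩ * eps - (k : hO.subring) * eps) = 0 := by
        rw [map_sub, map_mul, map_mul, map_intCast, hres_eps, hk1, sub_self]
      simpa only [AddSubgroupClass.coe_sub, Subring.coe_mul, Subring.coe_intCast, zsmul_eq_mul, heps]
        using res_eq_zero_iff.mp h
    · have h : hO.res p (eps * ⟨z, hz⟩ - (k : hO.subring) * eps) = 0 := by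
        rw [map_sub, map_mul, map_mul, map_intCast, hres_eps, hk2, sub_self]
      simpa only [AddSubgroupClass.coe_sub, Subring.coe_mul, Subring.coe_intCast, zsmul_eq_mul, heps]
        using res_eq_zero_iff.mp h
  have hzeps' : ∀ z ∈ O₁, ∃ k : ℤ, z * epsB' - k • epsB' ∈ (p : ℤ) • O₁ := by
    intro z hz
    obtain ⟨k, hk1, -⟩ := hO.exists_res_mul_eps hp hf hε' hε'0 hε'ε' hff hcenf (hO.res p ⟨z, hz⟩)
    refine ⟨k, ?_⟩
    have h : hO.res p (⟨z, hz⟩ * eps' - (k : hO.subring) * eps') = 0 := by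
      rw [map_sub, map_mul, map_mul, map_intCast, hres_eps', hk1, sub_self]
    simpa only [AddSubgroupClass.coe_sub, Subring.coe_mul, Subring.coe_intCast, zsmul_eq_mul, heps']
      using res_eq_zero_iff.mp h
  -- `𝔄` is left `O₁`-stable
  have hleft : ∀ z ∈ O₁, ∀ a ∈ 𝔄, z * a ∈ 𝔄 := fun z hz a ha => by
    obtain ⟨k, l, hkl⟩ := hmem𝔄.mp ha
    obtain ⟨k₁, hk₁, -⟩ := hzeps z hz
    obtain ⟨k₂, hk₂⟩ := hzeps' z hz
    have h1 : z * epsB ∈ 𝔄 := hmem𝔄.mpr ⟨k₁, 0, by rwa [zero_smul, add_zero]⟩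
    have h2 : z * epsB' ∈ 𝔄 := hmem𝔄.mpr ⟨0, k₂, by rwa [zero_smul, zero_add]⟩
    have h3 : z * (a - (k • epsB + l • epsB')) ∈ 𝔄 := hlow (hO.mul_smul_mem hz hkl)
    have : z * a = z * (a - (k • epsB + l • epsB')) + (k • (z * epsB) + l • (z * epsB')) := by
      rw [mul_sub, mul_add, mul_smul_comm, mul_smul_comm, sub_add_cancel]
    rw [this]
    exact 𝔄.add_mem h3 (𝔄.add_mem (𝔄.smul_mem k h1) (𝔄.smul_mem l h2))
  -- `ε̃ 𝔄 ⊆ p 𝔄`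
  have hy𝔄 : ∀ a ∈ 𝔄, epsB * a ∈ (p : ℤ) • 𝔄 := fun a ha => by
    obtain ⟨k, l, hkl⟩ := hmem𝔄.mp ha
    obtain ⟨b, hb, hab⟩ := (Submodule.mem_smul_pointwise_iff_exists _ _ O₁).mp hkl
    have ha_eq : a = k • epsB + l • epsB' + (p : ℤ) • b := by rw [hab]; abel
    rw [ha_eq, mul_add, mul_add, mul_smul_comm, mul_smul_comm, mul_smul_comm]
    refine Submodule.add_mem _ (Submodule.add_mem _ (Submodule.smul_mem _ k ?_) (Submodule.smul_mem _ l ?_))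
      (hsmul𝔄 ?_)
    · -- `ε̃² = p • (t' ε̃ − p n'''·1)` with `t' ε̃ − p n'''·1 ∈ 𝔄`
      have : epsB * epsB = (p : ℤ) • ((t' : ℤ) • epsB - ((p : ℤ) * n''') • (1 : B)) := by
        rw [hsq, hn''']
      rw [this]
      refine hsmul𝔄 (hmem𝔄.mpr ⟨t', 0, ?_⟩)
      rw [zero_smul, add_zero, sub_sub_cancel_left, mul_smul]
      exact Submodule.neg_mem _ (Submodule.smul_mem_pointwise_smul _ _ O₁ (O₁.smul_mem _ hO.one_mem))
    · -- `ε̃ ε̃' = E ε₀ (E F) (ε₀' F) ∈ p² O₁ ⊆ p 𝔄`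
      have : epsB * epsB' = E * ε₀ * (E * (1 - E)) * (ε₀' * (1 - E)) := by
        rw [hepsB, hepsB']; noncomm_ring
      rw [this]
      have hmem : E * ε₀ * (E * (1 - E)) * (ε₀' * (1 - E)) ∈ ((p : ℤ) * p) • O₁ :=
        hO.smul_mul_mem (hO.mul_smul_mem (hO.mul_mem _ hE _ ε₀.2) hEF)
          (hO.mul_mem _ ε₀'.2 _ (O₁.sub_mem hO.one_mem hE))
      obtain ⟨c, hc, hcc⟩ := (Submodule.mem_smul_pointwise_iff_exists _ _ O₁).mp hmem
      rw [← hcc, mul_smul]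
      exact hsmul𝔄 (hlow (Submodule.smul_mem_pointwise_smul _ _ O₁ hc))
    · -- `ε̃ b ∈ 𝔄`: `ε̃ b ≡ k' ε̃ (mod p)`
      obtain ⟨k', -, hk'⟩ := hzeps b hb
      exact hmem𝔄.mpr ⟨k', 0, by rwa [zero_smul, add_zero]⟩
  -- (M1)
  have hmem : epsB ∈ (p : ℤ) • O₁ := hmax.mem_smul_of_mul_le hpZ hlow hup hleft hpZ hy𝔄
  exact hε0 (by rw [← hres_eps, res_eq_zero_iff, heps]; exact hmem)

end IsZOrder

end Literature.NumberTheory.Automorphic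

end
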